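import Mathlib
import Literature.Barriers.MatrixMultiplication.NormalizerBarrier
import Literature.RepresentationTheory.FiniteGroups.IrreducibleCharacters
import Literature.RepresentationTheory.FiniteGroups.InducedClassFunction
import Summits.MatrixMultiplication.MatrixMultiplication.Theorems.LieRankDesigns.Negative.Basics
import Summits.MatrixMultiplication.MatrixMultiplication.Theorems.SubgroupIdentityDesigns.Negative.FlagCharacter
import Summits.MatrixMultiplication.MatrixMultiplication.Theorems.SubgroupIdentityDesigns.Negative.FlagOrbits
import Summits.MatrixMultiplication.MatrixMultiplication.Theorems.SubgroupIdentityDesigns.Negative.FlagDegree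
import Summits.MatrixMultiplication.MatrixMultiplication.Theorems.SubgroupIdentityDesigns.Negative.FlagNoGo

/-!
# General-`k` block-slice no-go for `l ≥ 4` and large `p`: the window `(k+1)⁶ ≤ p^{l-3}`

Supports stmt-MatrixMultiplication-14079 (crux `SubgroupIdentityDesigns`, route
    `LevelGradedCohnUmans`;
BLOCK-SLICES §2).  VALUE = theorem, NOT summit progress.

`FlagNoGo.no_translate_witness` uses the crude bound `k + 1 ≤ p^{⌈log₂(k+1)⌉}` to get a window
`l ≥ 3 + 6⌈log₂(k+1)⌉` uniform in `p`.  Keeping `p` explicit, the flag character `Ψ`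
(`⟨Ψ,Ψ⟩ ≤ (k+1)^k`, `Ψ(1) ≥ p^{kl + k(k-1)/2}`) closes the block-slice line as soon as
`(k+1)^{6k} ≤ p^{k(l-3)}`, i.e. **`(k+1)⁶ ≤ p^{l-3}`**:
* `threshold_of_pow_le` — `((k+1)^k)⁶ p^{3k²+5kl} ≤ (p^{kl} p^{∑_{i<k} i})⁶` under `l ≥ 3`,
  `(k+1)⁶ ≤ p^{l-3}` (the exponents then agree exactly: `k(l-3) + 3k² + 5kl = 6kl + 3k² - 3k`);
* **`no_translate_witness_of_pow_le`** / `no_slice_witness_of_pow_le` — for `k ≥ 1`, `l ≥ 3`,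
  `(k+1)⁶ ≤ p^{l-3}`, every `ε > 0` and every subgroup-TPP triple of `GL_{k+l}(𝔽_p)` with products
  in a translate `x S_{k+l,k} y`, the crux inequality FAILS;
* corollaries `no_translate_witness_four` (`l ≥ 4`, `p ≥ (k+1)⁶`), `no_translate_witness_six`
  (`l ≥ 6`, `p ≥ (k+1)²`), `no_translate_witness_nine` (`l ≥ 9`, `p ≥ k + 1`): for every fixed
  `l ≥ 4` only finitely many primes per `k` remain outside the unconditional no-go, and for `l ≥ 9`
  only the primes `p ≤ k`.
(`l = 3` would need a level-`k` character of norm `1` and degree `≥ p^{kl+k(k-1)/2}`, e.g. the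
parabolic induction of `k` distinct non-trivial characters — not formalised here.)
-/

set_option linter.dupNamespace false

noncomputable section

open scoped BigOperators Matrix Classical
open Literature.Barriers.MatrixMultiplication (SubgroupTPP)
open Literature.RepresentationTheory.FiniteGroups
open Summit.MatrixMultiplication.MatrixMultiplication.Theorems.LieRankDesigns.Negative

namespace Summit.MatrixMultiplication.MatrixMultiplication.Theorems.SubgroupIdentityDesigns.Negative
namespace FlagWindow

open FlagCharacter (flagChar isCharacter_flagChar flagChar_mem_levelSet flagChar_one_ne_zero)
open FlagOrbits (classInner_flagChar_le)
open FlagDegree (flagChar_one_ge two_mul_sum_range)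
open FlagNoGo (not_budget_lt_of_char_translate)

variable {p : ℕ} [hp : Fact p.Prime] {k l : ℕ}

/-- `6 ∑_{i<k} i + 3k = 3k²`. -/
theorem six_mul_sum_range (k : ℕ) : 6 * (∑ i ∈ Finset.range k, i) + 3 * k = 3 * (k * k) := by
  have h2e : 2 * (∑ i ∈ Finset.range k, i) = k * (k - 1) := two_mul_sum_range k
  rcases Nat.eq_zero_or_pos k with rfl | hk
  · simp
  · obtain ⟨k, rfl⟩ : ∃ k', k = k' + 1 := ⟨k - 1, by omega⟩
    rw [Nat.add_sub_cancel] at h2e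
    nlinarith [h2e]

omit hp in
/-- **Threshold with `p` explicit**: `l ≥ 3` and `(k+1)⁶ ≤ p^{l-3}` give
`((k+1)^k)⁶ p^{3k²+5kl} ≤ (p^{kl} p^{∑_{i<k} i})⁶. -/
theorem threshold_of_pow_le (hl : 3 ≤ l) (hpk : (k + 1) ^ 6 ≤ p ^ (l - 3)) :
    ((((k + 1) ^ k : ℕ) : ℝ)) ^ 6 * (p : ℝ) ^ (3 * (k * k) + 5 * k * l) ≤
      (((p ^ (k * l) * p ^ (∑ i ∈ Finset.range k, i) : ℕ) : ℝ)) ^ 6 := by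
  obtain ⟨l, rfl⟩ : ∃ l', l = l' + 3 := ⟨l - 3, by omega⟩
  rw [Nat.add_sub_cancel] at hpk
  set e := ∑ i ∈ Finset.range k, i with he
  have h6e : 6 * e + 3 * k = 3 * (k * k) := six_mul_sum_range k
  have h1 : ((k + 1) ^ k) ^ 6 ≤ p ^ (k * l) := by
    calc ((k + 1) ^ k) ^ 6 = ((k + 1) ^ 6) ^ k := by rw [← pow_mul, ← pow_mul, mul_comm]
      _ ≤ (p ^ l) ^ k := Nat.pow_le_pow_left hpk k
      _ = p ^ (k * l) := by rw [← pow_mul, mul_comm]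
  have hexp : k * l + (3 * (k * k) + 5 * k * (l + 3)) = (k * (l + 3) + e) * 6 := by
    nlinarith [h6e]
  have h2 : ((k + 1) ^ k) ^ 6 * p ^ (3 * (k * k) + 5 * k * (l + 3)) ≤
      (p ^ (k * (l + 3)) * p ^ e) ^ 6 := by
    calc ((k + 1) ^ k) ^ 6 * p ^ (3 * (k * k) + 5 * k * (l + 3))
        ≤ p ^ (k * l) * p ^ (3 * (k * k) + 5 * k * (l + 3)) := Nat.mul_le_mul_right _ h1
      _ = p ^ ((k * (l + 3) + e) * 6) := by rw [← pow_add, hexp]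
      _ = (p ^ (k * (l + 3)) * p ^ e) ^ 6 := by rw [← pow_add, ← pow_mul]
  exact_mod_cast h2

/-- **General-`k` block-slice no-go in the window `(k+1)⁶ ≤ p^{l-3}`** (`k ≥ 1`, `l ≥ 3`): for
every `ε > 0`, no subgroup-TPP triple of `GL_{k+l}(𝔽_p)` with products in a translate `x S_{k+l,k}
    y`
of the block slice satisfies the budget inequality of the crux `SubgroupIdentityDesigns`. -/
theorem no_translate_witness_of_pow_le (hk : 1 ≤ k) (hl : 3 ≤ l) (hpk : (k + 1) ^ 6 ≤ p ^ (l - 3))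
    {H₁ H₂ H₃ : Subgroup (GLm p (k + l))} (htpp : SubgroupTPP H₁ H₂ H₃) (x y : GLm p (k + l))
    (hS : ∀ a ∈ H₁, ∀ b ∈ H₂, ∀ c ∈ H₃, ∀ i j : Fin l,
      ((x⁻¹ * (a * b * c) * y⁻¹ : GLm p (k + l)) : Mat p (k + l)) (Fin.natAdd k i)
          (Fin.natAdd k j) = (1 : Matrix (Fin l) (Fin l) (ZMod p)) i j)
    {ε : ℝ} (hε : 0 < ε) :
    ¬ ((∑ᶠ ψ ∈ irrChars (GLm p (k + l)) ∩ levelSet p (k + l) k, (ψ 1).re ^ (2 + ε)) <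
        ((Nat.card H₁ * Nat.card H₂ * Nat.card H₃ : ℕ) : ℝ) ^ ((2 + ε) / 3)) :=
  not_budget_lt_of_char_translate hk (isCharacter_flagChar (F := ZMod p) (k := k) (l := l))
    flagChar_mem_levelSet flagChar_one_ne_zero (c := (((k + 1) ^ k : ℕ) : ℝ))
    (D := (((p ^ (k * l) * p ^ (∑ i ∈ Finset.range k, i) : ℕ) : ℝ))) (by positivity)
    classInner_flagChar_le (Nat.cast_nonneg _) flagChar_one_ge (threshold_of_pow_le hl hpk) htpp x
    y hS hε

/-- The block slice itself (`x = y = 1`). -/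
theorem no_slice_witness_of_pow_le (hk : 1 ≤ k) (hl : 3 ≤ l) (hpk : (k + 1) ^ 6 ≤ p ^ (l - 3))
    {H₁ H₂ H₃ : Subgroup (GLm p (k + l))} (htpp : SubgroupTPP H₁ H₂ H₃)
    (hS : ∀ a ∈ H₁, ∀ b ∈ H₂, ∀ c ∈ H₃, ∀ i j : Fin l,
      ((a * b * c : GLm p (k + l)) : Mat p (k + l)) (Fin.natAdd k i) (Fin.natAdd k j) =
        (1 : Matrix (Fin l) (Fin l) (ZMod p)) i j)
    {ε : ℝ} (hε : 0 < ε) :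
    ¬ ((∑ᶠ ψ ∈ irrChars (GLm p (k + l)) ∩ levelSet p (k + l) k, (ψ 1).re ^ (2 + ε)) <
        ((Nat.card H₁ * Nat.card H₂ * Nat.card H₃ : ℕ) : ℝ) ^ ((2 + ε) / 3)) :=
  no_translate_witness_of_pow_le hk hl hpk htpp 1 1
    (fun a ha b hb c hc i j => by simpa using hS a ha b hb c hc i j) hε

omit hp in
/-- From `(k+1)^a ≤ p` and `6 ≤ a (l - 3)` to the window hypothesis. -/
theorem pow_le_of_le {a : ℕ} (ha : 6 ≤ a * (l - 3)) (hp : (k + 1) ^ a ≤ p) :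
    (k + 1) ^ 6 ≤ p ^ (l - 3) :=
  calc (k + 1) ^ 6 ≤ (k + 1) ^ (a * (l - 3)) := Nat.pow_le_pow_right (Nat.succ_pos k) ha
    _ = ((k + 1) ^ a) ^ (l - 3) := pow_mul _ _ _
    _ ≤ p ^ (l - 3) := Nat.pow_le_pow_left hp _

/-- **`l ≥ 4`, `p ≥ (k+1)⁶`.** -/
theorem no_translate_witness_four (hk : 1 ≤ k) (hl : 4 ≤ l) (hp6 : (k + 1) ^ 6 ≤ p)
    {H₁ H₂ H₃ : Subgroup (GLm p (k + l))} (htpp : SubgroupTPP H₁ H₂ H₃) (x y : GLm p (k + l))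
    (hS : ∀ a ∈ H₁, ∀ b ∈ H₂, ∀ c ∈ H₃, ∀ i j : Fin l,
      ((x⁻¹ * (a * b * c) * y⁻¹ : GLm p (k + l)) : Mat p (k + l)) (Fin.natAdd k i)
          (Fin.natAdd k j) = (1 : Matrix (Fin l) (Fin l) (ZMod p)) i j)
    {ε : ℝ} (hε : 0 < ε) :
    ¬ ((∑ᶠ ψ ∈ irrChars (GLm p (k + l)) ∩ levelSet p (k + l) k, (ψ 1).re ^ (2 + ε)) <
        ((Nat.card H₁ * Nat.card H₂ * Nat.card H₃ : ℕ) : ℝ) ^ ((2 + ε) / 3)) :=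
  no_translate_witness_of_pow_le hk (by omega) (pow_le_of_le (a := 6) (by omega) hp6)
    htpp x y hS hε

/-- **`l ≥ 6`, `p ≥ (k+1)²`.** -/
theorem no_translate_witness_six (hk : 1 ≤ k) (hl : 6 ≤ l) (hp2 : (k + 1) ^ 2 ≤ p)
    {H₁ H₂ H₃ : Subgroup (GLm p (k + l))} (htpp : SubgroupTPP H₁ H₂ H₃) (x y : GLm p (k + l))
    (hS : ∀ a ∈ H₁, ∀ b ∈ H₂, ∀ c ∈ H₃, ∀ i j : Fin l,
      ((x⁻¹ * (a * b * c) * y⁻¹ : GLm p (k + l)) : Mat p (k + l)) (Fin.natAdd k i)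
          (Fin.natAdd k j) = (1 : Matrix (Fin l) (Fin l) (ZMod p)) i j)
    {ε : ℝ} (hε : 0 < ε) :
    ¬ ((∑ᶠ ψ ∈ irrChars (GLm p (k + l)) ∩ levelSet p (k + l) k, (ψ 1).re ^ (2 + ε)) <
        ((Nat.card H₁ * Nat.card H₂ * Nat.card H₃ : ℕ) : ℝ) ^ ((2 + ε) / 3)) :=
  no_translate_witness_of_pow_le hk (by omega)
    (pow_le_of_le (a := 2) (by omega) hp2)
    htpp x y hS hε

/-- **`l ≥ 9`, `p ≥ k + 1`**: for `l ≥ 9` only the primes `p ≤ k` are left outside the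
unconditional block-slice no-go. -/
theorem no_translate_witness_nine (hk : 1 ≤ k) (hl : 9 ≤ l) (hp1 : k + 1 ≤ p)
    {H₁ H₂ H₃ : Subgroup (GLm p (k + l))} (htpp : SubgroupTPP H₁ H₂ H₃) (x y : GLm p (k + l))
    (hS : ∀ a ∈ H₁, ∀ b ∈ H₂, ∀ c ∈ H₃, ∀ i j : Fin l,
      ((x⁻¹ * (a * b * c) * y⁻¹ : GLm p (k + l)) : Mat p (k + l)) (Fin.natAdd k i)
          (Fin.natAdd k j) = (1 : Matrix (Fin l) (Fin l) (ZMod p)) i j)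
    {ε : ℝ} (hε : 0 < ε) :
    ¬ ((∑ᶠ ψ ∈ irrChars (GLm p (k + l)) ∩ levelSet p (k + l) k, (ψ 1).re ^ (2 + ε)) <
        ((Nat.card H₁ * Nat.card H₂ * Nat.card H₃ : ℕ) : ℝ) ^ ((2 + ε) / 3)) :=
  no_translate_witness_of_pow_le hk (by omega)
    (pow_le_of_le (a := 1) (by omega) (by simpa using hp1)) htpp x y hS hε

end FlagWindow
end Summit.MatrixMultiplication.MatrixMultiplication.Theorems.SubgroupIdentityDesigns.Negative
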